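import Mathlib
import Summits.Ventures.PercRepro2.Defs
import Summits.Ventures.PercRepro2.Graph
import Summits.Ventures.PercRepro2.HullDefs
import Summits.Ventures.PercRepro2.LocRows
import Summits.Ventures.PercRepro2.SwRow

/-!
# Row (GADf): the red edges away from `C_R(h)` dominate under `C_B(h) ∈ 𝓥` (blind cell PercRepro2,
night-4 g8, 2026-08-25; proofs/NIGHT4-G8.md §3)

Free fibre (uniform 2-colouring, blue = `Hull.blue ζ`), marks `l, h`; `N = {h ∉ H_l}`; `T = C_R(h)`,
`T′ = C_B(h)`; `awayR ζ` = the red edges of `ζ` not inside `C_R(h)` (= the red edges of `G − T`).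

* **`GadF ends l h 𝓥`**: an injection of `{h ∉ H_l, C_R(h) ∈ 𝓥}` into `{h ∉ H_l, C_B(h) ∈ 𝓥}` along which
  `awayR` grows — the law of the red edges away from `C_R(h)` on `{N, C_B(h) ∈ 𝓥}` dominates its law
  on `{N, C_R(h) ∈ 𝓥}` (census: n ≤ 6, all 112 six-vertex graphs, all 168 up-sets, 0 failures);
* `cluster_subset_of_awayR`: the red cluster of `l ∉ C_R(h)` only uses edges away from `C_R(h)`, so it
  grows along the injection;
* **`sw_of_gadF`**: `(∀ 𝓥 up-set, GadF ends l h 𝓥) → Sw ends l h o` for every `o` — the instance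
  `f = 1[o ↔ l]` of the functional form gives the cancelled form `#{N, o ∈ A, T ∈ 𝓥} ≤ #{N, o ∈ A, T′ ∈ 𝓥}`
  of (SW), and the colour swap on the core class turns it into `sw_of_card_le`'s counting form.
-/

namespace Summit.Ventures.PercRepro2

namespace LocRows

open Hull

variable {V : Type*} {E : Type*} [Fintype E] [DecidableEq E]

open scoped Classical

variable (ends : E → Sym2 V)

/-- The red edges of `ζ` away from the red cluster of `h`. -/
def awayR (h : V) (ζ : Config E) : Set E :=
  {e | ζ e = true ∧ e ∉ within ends (cluster ends ζ h)}

/-- `{h ∉ H_l, C_R(h) ∈ 𝓥}`. -/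
noncomputable def srcF (l h : V) (𝓥 : Set (Set V)) : Finset (Config E) :=
  Finset.univ.filter fun ζ => h ∉ hull ends ζ l ∧ cluster ends ζ h ∈ 𝓥

/-- `{h ∉ H_l, C_B(h) ∈ 𝓥}`. -/
noncomputable def tgtF (l h : V) (𝓥 : Set (Set V)) : Finset (Config E) :=
  Finset.univ.filter fun ζ => h ∉ hull ends ζ l ∧ cluster ends (blue ζ) h ∈ 𝓥

/-- **Row (GADf)** at the up-set `𝓥`: an injection `srcF → tgtF` keeping every red edge away from
`C_R(h)` of the source red in the image (away from the image's `C_R(h)`). -/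
def GadF (l h : V) (𝓥 : Set (Set V)) : Prop :=
  ∃ f : {ζ // ζ ∈ srcF ends l h 𝓥} → Config E, Function.Injective f ∧
    ∀ x, f x ∈ tgtF ends l h 𝓥 ∧ awayR ends h x.1 ⊆ awayR ends h (f x)

variable {ends}

omit [Fintype E] [DecidableEq E] in
/-- The red cluster of `l` avoids the red cluster of `h` when `h ∉ C_R(l)`. -/
lemma disjoint_cluster_of_not_mem {l h : V} {ζ : Config E} (hh : h ∉ cluster ends ζ l) {x : V}
    (hx : x ∈ cluster ends ζ l) : x ∉ cluster ends ζ h := by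
  intro hxh
  apply hh
  simp only [mem_cluster] at hx hxh ⊢
  exact conn_trans hx (conn_symm hxh)

omit [Fintype E] [DecidableEq E] in
/-- **The red cluster of `l ∉ C_R(h)` grows along `awayR`**: it only uses red edges away from
`C_R(h)`. -/
lemma cluster_subset_of_awayR {l h : V} {ζ η : Config E} (hh : h ∉ cluster ends ζ l)
    (hsub : awayR ends h ζ ⊆ awayR ends h η) : cluster ends ζ l ⊆ cluster ends η l := by
  -- the configuration keeping only the red edges away from `C_R(h)`
  let ζ' : Config E := fun e => decide (e ∈ awayR ends h ζ)
  have h1 : cluster ends ζ' l = cluster ends ζ l := by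
    refine cluster_eq_of_eqOn_touches (ω := ζ) (ω' := ζ') ?_ rfl
    rintro e ⟨x, hx, y, hxy⟩
    have hnot : e ∉ within ends (cluster ends ζ h) := by
      rintro ⟨x', hx', y', hy', hxy'⟩
      rw [hxy, Sym2.eq_iff] at hxy'
      rcases hxy' with ⟨rfl, _⟩ | ⟨rfl, _⟩
      · exact disjoint_cluster_of_not_mem hh hx hx'
      · exact disjoint_cluster_of_not_mem hh hx hy'
    simp only [ζ', awayR, Set.mem_setOf_eq, hnot, not_false_eq_true, and_true]
    exact (Bool.decide_eq_true).symm
  have h2 : ζ' ≤ η := by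
    intro e
    simp only [ζ']
    by_cases he : e ∈ awayR ends h ζ
    · simp only [he, decide_true]
      exact le_of_eq (hsub he).1.symm
    · simp only [he, decide_false]
      exact Bool.false_le _
  rw [← h1]
  exact cluster_mono h2 l

/-- A member of the target side of (SW) with `o ∈ C_R(l)` has `h ∉ C_R(l)`. -/
lemma not_mem_cluster_of_mem_srcF {l h : V} {𝓥 : Set (Set V)} {ζ : Config E}
    (hζ : ζ ∈ srcF ends l h 𝓥) : h ∉ cluster ends ζ l := by
  simp only [srcF, Finset.mem_filter, Finset.mem_univ, true_and, hull, Set.mem_union,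
    not_or] at hζ
  exact hζ.1.1

/-- **The cancelled form of (SW) from (GADf)**: `#{N, o ∈ A, C_R(h) ∈ 𝓥} ≤ #{N, o ∈ A, C_B(h) ∈ 𝓥}`. -/
lemma card_cancelled_le_of_gadF {l h o : V} {𝓥 : Set (Set V)} (hg : GadF ends l h 𝓥) :
    ((srcF ends l h 𝓥).filter fun ζ => o ∈ cluster ends ζ l).card ≤
      ((tgtF ends l h 𝓥).filter fun ζ => o ∈ cluster ends ζ l).card := by
  obtain ⟨f, hf, hmem⟩ := hg
  -- the injection restricted to `{o ∈ A}`
  let s : Finset {ζ // ζ ∈ srcF ends l h 𝓥} :=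
    Finset.univ.filter fun x => o ∈ cluster ends x.1 l
  have hcard : ((srcF ends l h 𝓥).filter fun ζ => o ∈ cluster ends ζ l).card = s.card := by
    rw [Finset.card_filter, Finset.card_filter, ← Finset.sum_attach (srcF ends l h 𝓥)]
    rfl
  rw [hcard]
  refine Finset.card_le_card_of_injOn f ?_ fun x _ y _ hxy => hf hxy
  intro x hx
  rw [Finset.mem_coe, Finset.mem_filter] at hx
  rw [Finset.mem_coe, Finset.mem_filter]
  refine ⟨(hmem x).1, ?_⟩
  exact cluster_subset_of_awayR (not_mem_cluster_of_mem_srcF x.2) (hmem x).2 hx.2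

/-- The colour swap maps `{N, o ∈ B_side, C_B(h) ∈ 𝓥}` onto `{N, o ∈ R_side, C_R(h) ∈ 𝓥}`. -/
lemma card_src_swap (l h o : V) (𝓥 : Set (Set V)) :
    ((srcU ends l h {S : Set V | o ∈ S}).filter fun ζ => cluster ends (blue ζ) h ∈ 𝓥).card =
      ((srcF ends l h 𝓥).filter fun ζ =>
        o ∈ cluster ends ζ l ∧ o ∉ cluster ends (blue ζ) l).card := by
  refine Finset.card_bij (fun ζ _ => blue ζ) ?_ ?_ ?_
  · intro ζ hζ
    simp only [Finset.mem_filter, srcU, srcF, Finset.mem_univ, true_and, Set.mem_setOf_eq,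
      hull_blue, blue_blue] at hζ ⊢
    obtain ⟨⟨h1, h2, h3⟩, h4⟩ := hζ
    exact ⟨⟨h1, h4⟩, h2, h3⟩
  · intro ζ₁ _ ζ₂ _ h
    have := congrArg blue h
    simpa only [blue_blue] using this
  · intro η hη
    refine ⟨blue η, ?_, by simp only [blue_blue]⟩
    simp only [Finset.mem_filter, srcU, srcF, Finset.mem_univ, true_and, Set.mem_setOf_eq,
      hull_blue, blue_blue] at hη ⊢
    obtain ⟨⟨h1, h4⟩, h2, h3⟩ := hη
    exact ⟨⟨h1, h2, h3⟩, h4⟩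

/-- The colour swap maps the core class `{N, o ∈ K, C_R(h) ∈ 𝓥}` onto `{N, o ∈ K, C_B(h) ∈ 𝓥}`. -/
lemma card_core_swap (l h o : V) (𝓥 : Set (Set V)) :
    ((srcF ends l h 𝓥).filter fun ζ =>
        o ∈ cluster ends ζ l ∧ o ∈ cluster ends (blue ζ) l).card =
      ((tgtF ends l h 𝓥).filter fun ζ =>
        o ∈ cluster ends ζ l ∧ o ∈ cluster ends (blue ζ) l).card := by
  refine Finset.card_bij (fun ζ _ => blue ζ) ?_ ?_ ?_
  · intro ζ hζ
    simp only [Finset.mem_filter, srcF, tgtF, Finset.mem_univ, true_and, hull_blue,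
      blue_blue] at hζ ⊢
    obtain ⟨⟨h1, h4⟩, h2, h3⟩ := hζ
    exact ⟨⟨h1, h4⟩, h3, h2⟩
  · intro ζ₁ _ ζ₂ _ h
    have := congrArg blue h
    simpa only [blue_blue] using this
  · intro η hη
    refine ⟨blue η, ?_, by simp only [blue_blue]⟩
    simp only [Finset.mem_filter, srcF, tgtF, Finset.mem_univ, true_and, hull_blue,
      blue_blue] at hη ⊢
    obtain ⟨⟨h1, h4⟩, h2, h3⟩ := hη
    exact ⟨⟨h1, h4⟩, h3, h2⟩

/-- The target side of (SW) with `C_B(h) ∈ 𝓥` is `{N, o ∈ R_side, C_B(h) ∈ 𝓥}`. -/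
lemma card_tgt_eq (l h o : V) (𝓥 : Set (Set V)) :
    ((tgtU ends l h {S : Set V | o ∈ S}).filter fun ζ => cluster ends (blue ζ) h ∈ 𝓥).card =
      ((tgtF ends l h 𝓥).filter fun ζ =>
        o ∈ cluster ends ζ l ∧ o ∉ cluster ends (blue ζ) l).card := by
  congr 1
  ext ζ
  simp only [Finset.mem_filter, tgtU, tgtF, Finset.mem_univ, true_and, Set.mem_setOf_eq]
  tauto

omit [Fintype E] [DecidableEq E] in
/-- Splitting `{o ∈ A}` into `{o ∈ R_side}` and `{o ∈ K}`. -/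
lemma card_split (s : Finset (Config E)) (l o : V) :
    (s.filter fun ζ => o ∈ cluster ends ζ l).card =
      (s.filter fun ζ => o ∈ cluster ends ζ l ∧ o ∉ cluster ends (blue ζ) l).card +
        (s.filter fun ζ => o ∈ cluster ends ζ l ∧ o ∈ cluster ends (blue ζ) l).card := by
  rw [← Finset.card_filter_add_card_filter_not (fun ζ => o ∉ cluster ends (blue ζ) l)]
  simp only [Finset.filter_filter, not_not]

/-- **Row (GADf) for every up-set gives row (SW)** (for every `o`). -/
theorem sw_of_gadF {l h : V} (hg : ∀ 𝓥 : Set (Set V), IsUpperSet 𝓥 → GadF ends l h 𝓥) (o : V) :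
    Sw ends l h o := by
  refine sw_of_card_le ends l h o fun 𝓥 h𝓥 => ?_
  rw [card_src_swap, card_tgt_eq]
  have hc := card_cancelled_le_of_gadF (o := o) (hg 𝓥 h𝓥)
  rw [card_split (srcF ends l h 𝓥) l o, card_split (tgtF ends l h 𝓥) l o,
    card_core_swap l h o 𝓥] at hc
  omega

/-- Row (GADf) over all finite graphs, markings and up-sets. -/
def GadF_all : Prop :=
  ∀ (V E : Type) [Fintype V] [DecidableEq V] [Fintype E] [DecidableEq E] (ends : E → Sym2 V)
    (l h : V) (𝓥 : Set (Set V)), l ≠ h → IsUpperSet 𝓥 → GadF ends l h 𝓥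

/-- `GadF_all` gives `Sw_all`. -/
theorem sw_all_of_gadF_all (hg : GadF_all) : Sw_all := by
  intro V E _ _ _ _ ends l h o hlh _ _
  exact sw_of_gadF (fun 𝓥 h𝓥 => hg V E ends l h 𝓥 hlh h𝓥) o

end LocRows

end Summit.Ventures.PercRepro2
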